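import Summits.ResolutionOfSingularities.ResolutionOfSingularities.Theorems.FrobeniusClosingPatchingRelPerfectChartStrictTransform
import Summits.ResolutionOfSingularities.ResolutionOfSingularities.Theorems.FrobeniusClosingPatchingRelPerfectConeCubeSide
import HarnessLib

/-!
# Crux `PatchingRelPerfect` (stmt-ResolutionOfSingularities-16161), chain w52 — the rank-two member
# `f = x₀x₁ + x₂³`: the strict transform `V(e₁) ⊂ B_i` of the hyperplane `V(x₁)` is integral

[OURS · L1 W5.2 · rung, DESIGN STAGE → instance fact] One more hypothesis of the plane-step
assembly `…TwoPlanesPlane.isRegular_of_isBlowup_tpPlane` discharged: on the chart `B_i` (`i ≠ 1`)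
of `Bl_𝔪 Spec S`, `B_i ⧸ (e₁)` is a DOMAIN — it is the Rees chart of `Bl_{𝔪̄} Spec S/(x₁)`
(`ChartStrictTransform.exists_strictTransformHom` with `J = {1}`, `emb = Fin.succAbove 1`), and
`S/(x₁)` is a domain (`x₁` is a prime element of the regular local ring `S`) in which `x̄_i ≠ 0`.

* `isDomain_quot_span_x1` — `S/(x₁)` is a domain;
* `isDomain_quot_span_e1` — `B_i ⧸ (e₁)` is a domain for `i ≠ 1`.

`S` regular local of dimension four with regular system of parameters `x`; nothing here is a
statement of the manuscript under review.

## References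

* U. Görtz, T. Wedhorn, *Algebraic Geometry I*, 2nd ed. 2020, Prop. 13.96 (2). [GortzWedhorn2020]
* H. Matsumura, *Commutative Ring Theory*, CUP 1986, Thm. 14.2, 14.3. [Matsumura1987]
-/

-- `Summit.<Summit>.<Sub>.Theorems` with `Sub = Summit` (single-conjunct summit, D-0017)
set_option linter.dupNamespace false

noncomputable section

open CategoryTheory CategoryTheory.Limits AlgebraicGeometry Literature.AlgebraicGeometry.Resolution
open IsLocalRing

namespace Summit.ResolutionOfSingularities.ResolutionOfSingularities.Theorems

namespace TwoPlanesRung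

open ConeRung ChartStrictTransform

universe u

section Hyperplane

variable {S : Type u} [CommRing S] [IsRegularLocalRing S] (x : Fin 4 → S)
  (hx : Ideal.span (Set.range x) = IsLocalRing.maximalIdeal S)
  (hd : (IsLocalRing.maximalIdeal S).spanFinrank = 4)

include hx hd in
/-- `S/(x₁)` is a domain (`x₁` is prime, Matsumura 14.2–14.3). [cite: Matsumura1987, Thm. 14.3] -/
theorem isDomain_quot_span_x1 : IsDomain (S ⧸ Ideal.span {x 1}) := by
  have hz := isRsopPart_comp_of_rsop hd x hx id Function.injective_id
  have hp : Prime (x 1) := hz.prime 1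
  haveI := (Ideal.span_singleton_prime hp.ne_zero).mpr hp
  exact Ideal.Quotient.isDomain _

include hx hd in
/-- `x_i ∉ (x₁)` for `i ≠ 1`. [folklore] -/
theorem x_notMem_span_x1 (i : Fin 4) (hi : i ≠ 1) : x i ∉ Ideal.span {x 1} := by
  have h := not_mem_span_image_of_not_mem hd x hx (S := {1}) (i := i)
    (fun h => hi (Set.mem_singleton_iff.mp h))
  rwa [Set.image_singleton] at h

/-- `{1}` and the image of `Fin.succAbove 1` cover `Fin 4`. [folklore] -/
theorem cover_succAbove_one (i' : Fin 3) (j : Fin 4) :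
    (∃ k, Fin.succAbove (1 : Fin 4) k = j) ∨
      ∃ _ : Fin 1, ((⟨1, (Fin.succAbove_ne 1 i').symm⟩ :
        {j : Fin 4 // j ≠ Fin.succAbove (1 : Fin 4) i'}) : {j : Fin 4 // j ≠ Fin.succAbove 1 i'}).1 = j := by
  by_cases hj : j = 1
  · exact Or.inr ⟨0, hj.symm⟩
  · exact Or.inl (Fin.exists_succAbove_eq hj)

include hx hd in
/-- **`B_i ⧸ (e₁)` is a domain for `i ≠ 1`**: the strict transform of `V(x₁)` on the chart is the
Rees chart of `Bl_{𝔪̄} Spec S/(x₁)`. [cite: GortzWedhorn2020, Prop. 13.96 (2), p. 416] -/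
theorem isDomain_quot_span_e1 (i : Fin 4) (hi : i ≠ 1) :
    IsDomain (chartRing x i ⧸ Ideal.span {chartGen x i 1}) := by
  obtain ⟨i', rfl⟩ := Fin.exists_succAbove_eq hi
  have hqr := isQuasiRegular_regularSystemOfParameters hd x hx
  let jJ : Fin 1 → {j : Fin 4 // j ≠ Fin.succAbove (1 : Fin 4) i'} :=
    fun _ => ⟨1, (Fin.succAbove_ne 1 i').symm⟩
  obtain ⟨Θ, hΘ, -, -⟩ := exists_strictTransformHom x (Fin.succAbove (1 : Fin 4)) i' jJ hqr
    (Function.injective_of_subsingleton _) (cover_succAbove_one i')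
  -- the base `S/(x₁)` is a domain and `x̄_i ≠ 0` there
  have hQ : Ideal.span (Set.range fun k : Fin 1 => x (jJ k).1) = Ideal.span {x 1} := by
    change Ideal.span (Set.range fun _ : Fin 1 => x 1) = _
    rw [Set.range_const]
  haveI : IsDomain (S ⧸ Ideal.span (Set.range fun k : Fin 1 => x (jJ k).1)) := by
    rw [hQ]
    exact isDomain_quot_span_x1 x hx hd
  have hxb : (fun k : Fin 3 => Ideal.Quotient.mk (Ideal.span (Set.range fun k : Fin 1 => x (jJ k).1))
      (x (Fin.succAbove (1 : Fin 4) k))) i' ≠ 0 := by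
    intro h0
    have h1 : x (Fin.succAbove (1 : Fin 4) i') ∈
        Ideal.span (Set.range fun k : Fin 1 => x (jJ k).1) := Ideal.Quotient.eq_zero_iff_mem.mp h0
    rw [hQ] at h1
    exact x_notMem_span_x1 x hx hd _ (Fin.succAbove_ne 1 i') h1
  haveI := isDomain_chartRing (fun k : Fin 3 => Ideal.Quotient.mk
    (Ideal.span (Set.range fun k : Fin 1 => x (jJ k).1)) (x (Fin.succAbove (1 : Fin 4) k))) i' hxb
  have hEJ : Ideal.span (Set.range fun k : Fin 1 => chartGen x (Fin.succAbove (1 : Fin 4) i') (jJ k).1) =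
      Ideal.span {chartGen x (Fin.succAbove (1 : Fin 4) i') 1} := by
    change Ideal.span (Set.range fun _ : Fin 1 => chartGen x (Fin.succAbove (1 : Fin 4) i') 1) = _
    rw [Set.range_const]
  rw [← hEJ]
  exact MulEquiv.isDomain _ (RingEquiv.ofBijective Θ hΘ).toMulEquiv

end Hyperplane

end TwoPlanesRung

end Summit.ResolutionOfSingularities.ResolutionOfSingularities.Theorems

end
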